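import Literature.Analysis.FluidPDE.SereginSverakOffAxisTools
import Literature.Analysis.FluidPDE.SereginSverakSuitableProofs
import Literature.Analysis.FluidPDE.PressureDecayEstimate
import Literature.Analysis.FluidPDE.CKNEpsilonRegularity
import HarnessLib

/-!
# Seregin–Šverák 2009, (as15) proved from its inputs (via Seregin–Zajaczkowski 2007, Lemma 2.3)

Proofs-only companion of `SereginSverakOffAxisInputs.lean` (sources, printed proof, plan) and
`SereginSverakOffAxisTools.lean`. No definitions. Main result:

`SereginSverak2009.unitScaleOffAxisBound_of_inputs : OffAxisL6Bound → OffAxisSmoothRepresentative →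
  seregin_sverak_pressure_decay → lemarieRieusset_epsilon_regularity → UnitScaleOffAxisBound`,

the bound (as15) of the proof of Seregin–Šverák 2009, Prop. 3.7 (arXiv:0804.1803, p. 10) =
Seregin–Zajaczkowski 2007, Prop. 4.1 for the rescaled Type I pairs, from Cor. 4.4 (the `L₆`
bound, accepted named fact `SereginZajaczkowski2007.OffAxisL6Bound`, transported to these pairs
by `OffAxisSmoothRepresentative`), the decay estimate for the pressure (accepted named fact
`seregin_sverak_pressure_decay`), the suitability of the pairs (Remark 3.4, proved:
`SuitableOfBounded_holds`) and the one-scale ε-regularity criterion (accepted named fact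
`lemarieRieusset_epsilon_regularity`, Lemarié-Rieusset 2016, Thm. 14.4), following the printed
proof of Prop. 4.1 — "Applying Corollary 4.4 and Lemma 2.3" (arXiv:math/0702720, p. 7) — with the
velocity half of Lemma 2.3 proved in the a.e. form appropriate to the a.e. rendering of (as15):

* the hypotheses of the ε-regularity criterion on the domain `Ω = Q_{1/4}(z₀)` (connected) for a
  pair suitable in `Q(0,3)` with `𝒜₂ ≤ K`: `u ∈ L^∞_t L²_x(Ω)` (`energyClass_quarter`),
  `∇u ∈ L²(Ω)`, `p ∈ L^{3/2}(Ω)`, the equations in `𝒟'(Ω)`, and the local energy inequality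
  written with the GIVEN weak gradient `G` (`localEnergyIneq_of_isSuitable`: two weak spatial
  gradients agree a.e., accepted `HasWeakSpatialGradientOn.ae_eq`); hence `|u| ≤ C₀ε₀/ρ` a.e. on
  `Q_{ρ/2}(z₀)` once `∫_{Q_ρ(z₀)} (|u|³ + |p|^{3/2}) ≤ ε₀³ρ²` (`ae_bound_of_epsilonRegularity` —
  "according to the so-called ε-regularity theory … the latter implies `|v(z₀)| ≤ c/r₀`");
* the iteration: `D(s_k²; z₀) ≤ g_k` (`decayMajorant`) by the decay estimate between consecutive
  scales (the cylinders `Q_{s²}(z₀)` lie in `Q(0,3)`, where the pair solves the equations in `𝒟'`)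
  and the Hölder bound `C(s_k²; z₀) ≤ a_K s_k`, `a_K = (|B₁|Φ₆(K))^{1/2}`; at the index
  `k₀ = epsIndex c σ ε₀³ a_K (16K)` the smallness holds at the scale `ρ_K = s_{k₀}²`;
* the covering of `Q¹₁(0)` by countably many cylinders `Q_{ρ_K/2}(z₀)` with centres in
  `𝒞(1,2;1) × ]-1,0[` (`ae_innerShell_of_centres`), which replaces the pointwise evaluation
  `|v(z₀)|` of the printed Lemma 2.3 in the a.e. rendering;
* the corollary `axisDecayBound_of_inputs`: Prop. 3.7 from Lemma 3.5 and these inputs.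

The function of (as15) obtained is `Φ(K) = C₀ ε₀ / ρ_K`, non-decreasing because `k₀(K)` is. The
gradient half `|∇u|` of (4.1) is not part of the rendered (as15) and is not proved (the accepted
ε-regularity criterion bounds the velocity only).

## References

* G. Seregin, V. Šverák, Comm. PDE 34 (2009), arXiv:0804.1803, Remark 3.4 (p. 9), proof of
  Prop. 3.7 (p. 10). [`SereginSverak2009`]
* G. Seregin, W. Zajaczkowski, SIAM J. Math. Anal. 39 (2007), arXiv:math/0702720, Lemma 2.3 and
  its proof (p. 3), proof of Prop. 4.1 (p. 7). [`SereginZajaczkowski2007`]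
* P. G. Lemarié-Rieusset, *The Navier–Stokes Problem in the 21st Century*, CRC Press (2016),
  Thm. 14.4 (p. 505). [`LemarieRieusset2016`]
-/

noncomputable section

open MeasureTheory Set Function Filter Topology TopologicalSpace Module Metric
open scoped NNReal ENNReal InnerProductSpace RealInnerProductSpace Laplacian

namespace Literature.Analysis.FluidPDE

namespace SereginSverak2009

open SereginZajaczkowski2007

variable {u : ℝ → (EuclideanSpace ℝ (Fin 3)) → (EuclideanSpace ℝ (Fin 3))} {p : ℝ → (EuclideanSpace ℝ (Fin 3)) → ℝ}

/-! ### The hypotheses of the ε-regularity criterion on `Q_{1/4}(z₀)` -/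

section EpsReg

variable {G : ℝ → (EuclideanSpace ℝ (Fin 3)) → (EuclideanSpace ℝ (Fin 3)) →L[ℝ] (EuclideanSpace ℝ (Fin 3))} {K : ℝ≥0} {z₀ : ℝ × (EuclideanSpace ℝ (Fin 3))}

/-- Backward parabolic cylinders are connected (convex and non-empty for `r > 0`). [folklore] -/
theorem isConnected_parabolicCylinder {r : ℝ} (hr : 0 < r) (z : ℝ × (EuclideanSpace ℝ (Fin 3))) :
    IsConnected (parabolicCylinder r z) := by
  refine ⟨⟨(z.1 - r ^ 2 / 2, z.2), ?_⟩, ?_⟩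
  · rw [mem_parabolicCylinder]
    exact ⟨⟨by nlinarith, by nlinarith⟩, by simpa using hr⟩
  · exact ((convex_Ioo _ _).prod (convex_ball _ _)).isPreconnected

/-- `Q_ρ(z₀) ⊆ Q_{1/4}(z₀)` for `0 ≤ ρ ≤ 1/4`. [folklore] -/
theorem parabolicCylinder_subset_quarter {ρ : ℝ} (hρ : 0 ≤ ρ) (hρ4 : ρ ≤ 1 / 4) (z : ℝ × (EuclideanSpace ℝ (Fin 3))) :
    parabolicCylinder ρ z ⊆ parabolicCylinder (1 / 4) z := by
  have h2 : ρ ^ 2 ≤ (1 / 4) ^ 2 := pow_le_pow_left₀ hρ hρ4 2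
  exact prod_mono (Ioo_subset_Ioo (by linarith) le_rfl) (ball_subset_ball hρ4)

/-- The energy class `(ℋ_CKN)` on `Ω = Q_{1/4}(z₀)`: `∫ 1_Ω |u(t)|² dx ≤ K` for a.e. `t`, from the
first term of `𝒜₂ ≤ K` (`B(x₀, 1/4) ⊆ 𝒫²₁(0)` and `]t₀ - 1/16, t₀[ ⊆ ]-4, 0[`). [folklore] -/
theorem energyClass_quarter (h₀ : z₀ ∈ shellCyl 1 2 1 1)
    (hA : ∀ᵐ s ∂(volume.restrict (Ioo (-2 ^ 2 : ℝ) 0)),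
      ∫⁻ y in outerShellSpace 1 0, ‖u s y‖ₑ ^ 2 ≤ K) :
    ∃ C : ℝ≥0, ∀ᵐ t : ℝ, ∫⁻ x, (parabolicCylinder (1 / 4) z₀).indicator
      (fun z : ℝ × (EuclideanSpace ℝ (Fin 3)) => ‖u z.1 z.2‖ₑ ^ 2) (t, x) ≤ C := by
  refine ⟨K, ?_⟩
  obtain ⟨⟨ht1, ht2⟩, -, -⟩ := mem_shellCyl.1 h₀
  norm_num at ht1
  have hA' := (ae_restrict_iff' (measurableSet_Ioo : MeasurableSet (Ioo (-2 ^ 2 : ℝ) 0))).1 hA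
  filter_upwards [hA'] with t ht
  by_cases htI : z₀.1 - (1 / 4) ^ 2 < t ∧ t < z₀.1
  · have ht4 : t ∈ Ioo (-2 ^ 2 : ℝ) 0 := by
      refine ⟨?_, htI.2.trans ht2⟩
      norm_num
      linarith
    have e : (fun x => (parabolicCylinder (1 / 4) z₀).indicator
        (fun z : ℝ × (EuclideanSpace ℝ (Fin 3)) => ‖u z.1 z.2‖ₑ ^ 2) (t, x)) =
        (ball z₀.2 (1 / 4)).indicator fun x => ‖u t x‖ₑ ^ 2 := by
      funext x
      by_cases hx : x ∈ ball z₀.2 (1 / 4)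
      · rw [indicator_of_mem hx, indicator_of_mem]
        exact ⟨htI, hx⟩
      · rw [indicator_of_notMem hx, indicator_of_notMem]
        exact fun h => hx h.2
    rw [e, lintegral_indicator measurableSet_ball]
    refine le_trans (lintegral_mono_set ?_) (ht ht4)
    exact (ball_subset_spaceCyl _ _).trans
      (spaceCyl_subset_outerShellSpace h₀ (by norm_num) le_rfl)
  · have e : (fun x => (parabolicCylinder (1 / 4) z₀).indicator
        (fun z : ℝ × (EuclideanSpace ℝ (Fin 3)) => ‖u z.1 z.2‖ₑ ^ 2) (t, x)) = fun _ => 0 := by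
      funext x
      rw [indicator_of_notMem]
      exact fun h => htI ((mem_parabolicCylinder.1 h).1)
    rw [e, lintegral_zero]
    exact bot_le

/-- **The local energy inequality with the given gradient.** A suitable weak solution on `Q`
satisfies the local energy inequality (CKN (2.5)) written with ANY weak spatial gradient `G` of
`u` on `Q` (two weak gradients agree a.e. on `Q`, `HasWeakSpatialGradientOn.ae_eq`, and the test
function vanishes off `Q`). [folklore] -/
theorem localEnergyIneq_of_isSuitable {Q : Opens (ℝ × (EuclideanSpace ℝ (Fin 3)))}
    (hs : IsSuitableWeakSolutionOn Q 1 0 u p) (hG : HasWeakSpatialGradientOn Q u G) :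
    ∀ φ : ℝ → (EuclideanSpace ℝ (Fin 3)) → ℝ, IsSpaceTimeTestOn Q φ → (∀ t x, 0 ≤ φ t x) →
      2 * (1 : ℝ) * ∫ t, ∫ x, frobeniusNormSq (G t x) * φ t x ≤
        ∫ t, ∫ x, (‖u t x‖ ^ 2 * (timeDeriv φ t x + 1 * Δ (φ t) x) +
          (‖u t x‖ ^ 2 + 2 * p t x) * ⟪u t x, gradient (φ t) x⟫ +
          2 * ⟪(0 : ℝ → (EuclideanSpace ℝ (Fin 3)) → (EuclideanSpace ℝ (Fin 3))) t x, u t x⟫ * φ t x) := by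
  obtain ⟨G', hG', -, hLE⟩ := hs.localEnergy
  have hGG' := (ae_restrict_iff' Q.isOpen.measurableSet).1 (hG.ae_eq hG')
  intro φ hφ hφ0
  have hsupp : ∀ z : ℝ × (EuclideanSpace ℝ (Fin 3)), z ∉ (Q : Set (ℝ × (EuclideanSpace ℝ (Fin 3)))) → φ z.1 z.2 = 0 := fun z hz =>
    show uncurry φ z = 0 from image_eq_zero_of_notMem_tsupport fun h => hz (hφ.tsupport_subset h)
  have e : ∫ t, ∫ x, frobeniusNormSq (G t x) * φ t x =
      ∫ t, ∫ x, frobeniusNormSq (G' t x) * φ t x := by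
    have hae : ∀ᵐ z : ℝ × (EuclideanSpace ℝ (Fin 3)) ∂(volume : Measure ℝ).prod (volume : Measure (EuclideanSpace ℝ (Fin 3))),
        frobeniusNormSq (G z.1 z.2) * φ z.1 z.2 = frobeniusNormSq (G' z.1 z.2) * φ z.1 z.2 := by
      rw [← Measure.volume_eq_prod]
      filter_upwards [hGG'] with z hz
      by_cases hzQ : z ∈ (Q : Set (ℝ × (EuclideanSpace ℝ (Fin 3))))
      · have h1 : G z.1 z.2 = G' z.1 z.2 := hz hzQ
        rw [h1]
      · rw [hsupp z hzQ, mul_zero, mul_zero]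
    have h2 := Measure.ae_ae_of_ae_prod (p := fun z : ℝ × (EuclideanSpace ℝ (Fin 3)) =>
      frobeniusNormSq (G z.1 z.2) * φ z.1 z.2 = frobeniusNormSq (G' z.1 z.2) * φ z.1 z.2) hae
    refine integral_congr_ae ?_
    filter_upwards [h2] with t ht
    exact integral_congr_ae ht
  rw [e]
  exact hLE φ hφ hφ0

/-- **Seregin–Zajaczkowski 2007, Lemma 2.3, last step, in the form used here** ("according to the
so-called ε-regularity theory, see, for example, [LS], [ESS4], and [S8], the latter implies …
`|v(z₀)| ≤ c/r₀`", arXiv p. 3), with the ε-regularity theory taken in the accepted one-scale form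
`lemarieRieusset_epsilon_regularity` (Lemarié-Rieusset 2016, Thm. 14.4, at `ν = 1`, `q = 3`,
`f = 0`, specialised below as the hypothesis `H`): for a pair that is suitable in `Q(0, 3)` with
`𝒜₂ ≤ K`, an admissible centre `z₀` and a scale `0 < ρ ≤ 1/4` at which
`∫_{Q_ρ(z₀)} (|u|³ + |p|^{3/2}) ≤ ε₀³ ρ²`, the criterion applies on the domain `Ω = Q_{1/4}(z₀)`
(connected; `u ∈ L^∞_t L²_x(Ω)`, `∇u ∈ L²(Ω)`, `p ∈ L^{3/2}(Ω)` by `𝒜₂ ≤ K`; the local energy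
inequality from suitability) and bounds `|u| ≤ C₀ ε₀ / ρ` a.e. on `Q_{ρ/2}(z₀)`.
[cite: SereginZajaczkowski2007, proof of Lemma 2.3 (arXiv p. 3)] -/
theorem ae_bound_of_epsilonRegularity {ε₀ C₀ : ℝ}
    (H : ∀ (Q : Opens (ℝ × (EuclideanSpace ℝ (Fin 3)))) (f u : ℝ → (EuclideanSpace ℝ (Fin 3)) → (EuclideanSpace ℝ (Fin 3))) (p : ℝ → (EuclideanSpace ℝ (Fin 3)) → ℝ)
        (G : ℝ → (EuclideanSpace ℝ (Fin 3)) → (EuclideanSpace ℝ (Fin 3)) →L[ℝ] (EuclideanSpace ℝ (Fin 3))),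
      IsConnected (Q : Set (ℝ × (EuclideanSpace ℝ (Fin 3)))) →
      (∃ C : ℝ≥0, ∀ᵐ t : ℝ,
        ∫⁻ x, (Q : Set (ℝ × (EuclideanSpace ℝ (Fin 3)))).indicator (fun z : ℝ × (EuclideanSpace ℝ (Fin 3)) => ‖u z.1 z.2‖ₑ ^ 2) (t, x) ≤ C) →
      HasWeakSpatialGradientOn Q u G →
      ∫⁻ z in (Q : Set (ℝ × (EuclideanSpace ℝ (Fin 3)))), ENNReal.ofReal (frobeniusNormSq (G z.1 z.2)) < ∞ →
      ∫⁻ z in (Q : Set (ℝ × (EuclideanSpace ℝ (Fin 3)))), ‖p z.1 z.2‖ₑ ^ (3 / 2 : ℝ) < ∞ →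
      MemLp (uncurry f) (ENNReal.ofReal 3) (volume.restrict (Q : Set (ℝ × (EuclideanSpace ℝ (Fin 3))))) →
      IsDistributionalNSSolutionOn Q 1 f u p →
      (∀ φ : ℝ → (EuclideanSpace ℝ (Fin 3)) → ℝ, IsSpaceTimeTestOn Q φ → (∀ t x, 0 ≤ φ t x) →
        2 * (1 : ℝ) * ∫ t, ∫ x, frobeniusNormSq (G t x) * φ t x ≤
          ∫ t, ∫ x, (‖u t x‖ ^ 2 * (timeDeriv φ t x + 1 * Δ (φ t) x) +
            (‖u t x‖ ^ 2 + 2 * p t x) * ⟪u t x, gradient (φ t) x⟫ +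
            2 * ⟪f t x, u t x⟫ * φ t x)) →
      ∀ (z₀ : ℝ × (EuclideanSpace ℝ (Fin 3))) (r₀ l : ℝ), 0 < r₀ →
        parabolicCylinder r₀ z₀ ⊆ (Q : Set (ℝ × (EuclideanSpace ℝ (Fin 3)))) → 0 ≤ l → l ≤ ε₀ →
        ∫⁻ w in parabolicCylinder r₀ z₀,
            (‖u w.1 w.2‖ₑ ^ (3 : ℕ) + ‖p w.1 w.2‖ₑ ^ (3 / 2 : ℝ)) ≤
          ENNReal.ofReal (l ^ 3 * r₀ ^ 2) →
        ∫⁻ w in parabolicCylinder r₀ z₀, ‖f w.1 w.2‖ₑ ^ (3 : ℝ) ≤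
          ENNReal.ofReal (l ^ ((2 : ℝ) * 3) * r₀ ^ ((5 : ℝ) - 3 * 3)) →
        ∀ᵐ w ∂(volume.restrict (parabolicCylinder (r₀ / 2) z₀)), ‖u w.1 w.2‖ ≤ C₀ * l / r₀)
    (hε₀ : 0 < ε₀) (h₀ : z₀ ∈ shellCyl 1 2 1 1)
    (hsuit : IsSuitableWeakSolutionOn (parCylOpens 0 3) 1 0 u p)
    (hG : HasWeakSpatialGradientOn (parCylOpens 0 3) u G)
    (hA : ∀ᵐ s ∂(volume.restrict (Ioo (-2 ^ 2 : ℝ) 0)),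
      ∫⁻ y in outerShellSpace 1 0, ‖u s y‖ₑ ^ 2 ≤ K)
    (hE : (∫⁻ z in outerShell 1 0, ENNReal.ofReal (frobeniusNormSq (G z.1 z.2))) ≤ K)
    (hD : (∫⁻ z in outerShell 1 0, ‖p z.1 z.2‖ₑ ^ (3 / 2 : ℝ)) ≤ K)
    {ρ : ℝ} (hρ : 0 < ρ) (hρ4 : ρ ≤ 1 / 4)
    (hsmall : ∫⁻ w in parabolicCylinder ρ z₀,
        (‖u w.1 w.2‖ₑ ^ (3 : ℕ) + ‖p w.1 w.2‖ₑ ^ (3 / 2 : ℝ)) ≤ ENNReal.ofReal (ε₀ ^ 3 * ρ ^ 2)) :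
    ∀ᵐ w ∂(volume.restrict (parabolicCylinder (ρ / 2) z₀)), ‖u w.1 w.2‖ ≤ C₀ * ε₀ / ρ := by
  set Q : Opens (ℝ × (EuclideanSpace ℝ (Fin 3))) := parabolicCylinderOpens (1 / 4) z₀ with hQdef
  have hQ : (Q : Set (ℝ × (EuclideanSpace ℝ (Fin 3)))) = parabolicCylinder (1 / 4) z₀ := rfl
  have hQ14 : (Q : Set (ℝ × (EuclideanSpace ℝ (Fin 3)))) ⊆ parCyl z₀ (1 / 4) := parabolicCylinder_subset_parCyl _ _
  have hQsh : (Q : Set (ℝ × (EuclideanSpace ℝ (Fin 3)))) ⊆ outerShell 1 0 :=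
    hQ14.trans (parCyl_subset_outerShell h₀ le_rfl)
  have hQ3' : (Q : Set (ℝ × (EuclideanSpace ℝ (Fin 3)))) ⊆ parCyl 0 3 := hQ14.trans (parCyl_subset_parCyl_three h₀ le_rfl)
  have hQ3 : Q ≤ parCylOpens 0 3 := hQ3'
  have hconn : IsConnected (Q : Set (ℝ × (EuclideanSpace ℝ (Fin 3)))) := isConnected_parabolicCylinder (by norm_num) z₀
  have hen := energyClass_quarter (u := u) h₀ hA
  have hGQ : HasWeakSpatialGradientOn Q u G := hG.mono hQ3
  have hGfin : ∫⁻ z in (Q : Set (ℝ × (EuclideanSpace ℝ (Fin 3)))), ENNReal.ofReal (frobeniusNormSq (G z.1 z.2)) < ∞ :=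
    ((lintegral_mono_set hQsh).trans hE).trans_lt ENNReal.coe_lt_top
  have hpfin : ∫⁻ z in (Q : Set (ℝ × (EuclideanSpace ℝ (Fin 3)))), ‖p z.1 z.2‖ₑ ^ (3 / 2 : ℝ) < ∞ :=
    ((lintegral_mono_set hQsh).trans hD).trans_lt ENNReal.coe_lt_top
  have hf : MemLp (uncurry (0 : ℝ → (EuclideanSpace ℝ (Fin 3)) → (EuclideanSpace ℝ (Fin 3)))) (ENNReal.ofReal 3)
      (volume.restrict (Q : Set (ℝ × (EuclideanSpace ℝ (Fin 3))))) :=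
    (MemLp.zero : MemLp (0 : ℝ × (EuclideanSpace ℝ (Fin 3)) → (EuclideanSpace ℝ (Fin 3))) (ENNReal.ofReal 3) (volume.restrict (Q : Set (ℝ × (EuclideanSpace ℝ (Fin 3))))))
  have hdist : IsDistributionalNSSolutionOn Q 1 0 u p := hsuit.distributional.of_le hQ3
  have hLEI := localEnergyIneq_of_isSuitable (hsuit.of_le hQ3) hGQ
  have hsub : parabolicCylinder ρ z₀ ⊆ (Q : Set (ℝ × (EuclideanSpace ℝ (Fin 3)))) :=
    parabolicCylinder_subset_quarter hρ.le hρ4 z₀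
  have hf0 : ∫⁻ w in parabolicCylinder ρ z₀, ‖(0 : ℝ → (EuclideanSpace ℝ (Fin 3)) → (EuclideanSpace ℝ (Fin 3))) w.1 w.2‖ₑ ^ (3 : ℝ) ≤
      ENNReal.ofReal (ε₀ ^ ((2 : ℝ) * 3) * ρ ^ ((5 : ℝ) - 3 * 3)) := by
    simp
  exact H Q 0 u p G hconn hen hGQ hGfin hpfin hf hdist hLEI z₀ ρ ε₀ hρ hsub hε₀.le le_rfl hsmall hf0

end EpsReg

/-! ### Countably many cylinders `Q_{ρ/2}(z₀)` cover `Q¹₁(0)` -/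

/-- An a.e. statement on every `Q_{ρ/2}(z₀)`, `z₀` an admissible centre, holds a.e. on
`Q¹₁(0) = 𝒞(1,2;1) × ]-1, 0[`: through a.e. point pass such cylinders with centres in the
countable family `ℚ × (dense sequence of ℝ³)` (this replaces the pointwise evaluation
`z ↦ |v(z₀)|` of the printed Lemma 2.3 for the a.e. rendering). [folklore] -/
theorem ae_innerShell_of_centres {P : ℝ × (EuclideanSpace ℝ (Fin 3)) → Prop} {ρ : ℝ} (hρ : 0 < ρ)
    (h : ∀ z₀ ∈ shellCyl 1 2 1 1, ∀ᵐ w ∂(volume.restrict (parabolicCylinder (ρ / 2) z₀)), P w) :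
    ∀ᵐ z ∂(volume.restrict (innerShell 1 0)), P z := by
  set ctr : ℚ × ℕ → ℝ × (EuclideanSpace ℝ (Fin 3)) := fun qn => ((qn.1 : ℝ), denseSeq (EuclideanSpace ℝ (Fin 3)) qn.2) with hctr
  have hall : ∀ᵐ z ∂(volume : Measure (ℝ × (EuclideanSpace ℝ (Fin 3)))), ∀ qn : ℚ × ℕ, ctr qn ∈ shellCyl 1 2 1 1 →
      z ∈ parabolicCylinder (ρ / 2) (ctr qn) → P z := by
    rw [ae_all_iff]
    intro qn
    by_cases hc : ctr qn ∈ shellCyl 1 2 1 1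
    · have := (ae_restrict_iff' (isOpen_parabolicCylinder _ _).measurableSet).1 (h _ hc)
      filter_upwards [this] with z hz _ hmem using hz hmem
    · exact Eventually.of_forall fun z h1 => absurd h1 hc
  refine (ae_restrict_iff' (measurableSet_innerShell 1 0)).2 ?_
  filter_upwards [hall] with z hz hzS
  obtain ⟨⟨ht1, ht2⟩, ⟨hc1, hc2⟩, hx3⟩ := mem_innerShell.1 hzS
  rw [sub_zero] at hx3
  norm_num at ht1 hc2
  -- an open neighbourhood of `z.2` inside `𝒫 = {1 < |x'| < 2, |x₃| < 1}`
  set U : Set (EuclideanSpace ℝ (Fin 3)) := {x | cylRadius x ∈ Ioo (1 : ℝ) 2 ∧ |x 2| < 1} with hU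
  have hUo : IsOpen U := by
    have h1 : Continuous fun x : (EuclideanSpace ℝ (Fin 3)) => |x 2| := by fun_prop
    exact (isOpen_Ioo.preimage continuous_cylRadius).inter (isOpen_lt h1 continuous_const)
  have hzU : z.2 ∈ U := ⟨⟨hc1, hc2⟩, hx3⟩
  obtain ⟨δ, hδ, hball⟩ := Metric.isOpen_iff.1 hUo z.2 hzU
  obtain ⟨n, hn⟩ := (denseRange_denseSeq (EuclideanSpace ℝ (Fin 3))).exists_dist_lt z.2 (lt_min hδ (half_pos hρ))
  have hnU : denseSeq (EuclideanSpace ℝ (Fin 3)) n ∈ U := hball (mem_ball'.2 (hn.trans_le (min_le_left _ _)))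
  have hnρ : dist z.2 (denseSeq (EuclideanSpace ℝ (Fin 3)) n) < ρ / 2 := hn.trans_le (min_le_right _ _)
  -- a rational time slightly above `z.1`
  have hρ2 : 0 < (ρ / 2) ^ 2 := by positivity
  obtain ⟨q, hq1, hq2⟩ := exists_rat_btwn (lt_min ht2 (show z.1 < z.1 + (ρ / 2) ^ 2 by linarith))
  have hq0 : (q : ℝ) < 0 := hq2.trans_le (min_le_left _ _)
  have hqρ : (q : ℝ) < z.1 + (ρ / 2) ^ 2 := hq2.trans_le (min_le_right _ _)
  refine hz (q, n) (mem_shellCyl.2 ⟨⟨by norm_num; linarith, hq0⟩, hnU.1, hnU.2⟩) ?_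
  rw [mem_parabolicCylinder]
  exact ⟨⟨by simp only [hctr]; linarith, hq1⟩, hnρ⟩

/-! ### (as15) from its inputs -/

/-- **Seregin–Šverák 2009, (as15), from its printed inputs.** The bound (as15) of the proof of
Prop. 3.7 (= Seregin–Zajaczkowski 2007, Prop. 4.1, for the rescaled Type I pairs; the named fact
`UnitScaleOffAxisBound`) follows from

* `SereginZajaczkowski2007.OffAxisL6Bound` — SZ2007, Cor. 4.4 (the `L₆` bound for the smooth
  class), transported to the pairs at hand by `OffAxisSmoothRepresentative`
  (`sixthPower_le_of_offAxisL6Bound`);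
* `seregin_sverak_pressure_decay` — the decay estimate for the pressure ((2.2) of SZ2007 = (as13)
  of SS2009, ball form) for distributional solutions;
* `lemarieRieusset_epsilon_regularity` — the one-scale ε-regularity criterion (Lemarié-Rieusset
  2016, Thm. 14.4; "the ε-regularity theory [LS], [ESS4], [S8]" of SZ2007),

and the proved suitability of the pairs on `Q(0, 3)` (Remark 3.4, `SuitableOfBounded_holds`,
transported by `IsTypeIAxisymmetricSolutionOn.isSuitable`), exactly along the printed proof of
Prop. 4.1 — "Applying Corollary 4.4 and Lemma 2.3" (SZ2007, p. 7) — with the velocity half of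
Lemma 2.3 proved here in the a.e. form: fix `τ = σ²` with `cσ² ≤ 1/2` (`c` the constant of the
decay estimate); for a pair with `𝒜₂ ≤ K` and a centre `z₀ ∈ 𝒞(1,2;1) × ]-1,0[` the Hölder step
gives `C(s²; z₀) ≤ a_K s`, `a_K = (|B₁| Φ₆(K))^{1/2}`, at every scale `s = s_k = σ^k/2`
(`cknC_le_of_sixth_bound`), the decay estimate between consecutive scales (`Q_{s²}(z₀) ⊆ Q(0,3)`,
where the pair solves the equations in `𝒟'`) gives `D(s_{k+1}²; z₀) ≤ ½ D(s_k²; z₀) + cσ⁻⁴ a_K s_k`,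
whence `D(s_k²; z₀) ≤ g_k` for the explicit majorant `decayMajorant c σ a_K (16K)`
(`D(1/4; z₀) ≤ 16K`); at the first index `k₀ = k₀(K)` with `g_{k₀} + a_K s_{k₀} ≤ ε₀³` (`epsIndex`,
monotone in `K`) the scale `ρ_K = s_{k₀}²` satisfies
`∫_{Q_{ρ_K}(z₀)} (|u|³ + |p|^{3/2}) = ρ_K² (C + D)(ρ_K; z₀) ≤ ε₀³ ρ_K²`, and the ε-regularity
criterion on `Ω = Q_{1/4}(z₀)` bounds `|u| ≤ C₀ε₀/ρ_K` a.e. on `Q_{ρ_K/2}(z₀)`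
(`ae_bound_of_epsilonRegularity`); countably many such cylinders cover `Q¹₁(0)`
(`ae_innerShell_of_centres`). The function of (as15) is `Φ(K) = C₀ ε₀ / ρ_K`, non-decreasing
because `k₀(K)` is. [cite: SereginSverak2009, proof of Prop. 3.7, (as15) (arXiv p. 10)] -/
theorem unitScaleOffAxisBound_of_inputs (h44 : OffAxisL6Bound) (hreg : OffAxisSmoothRepresentative)
    (h22 : seregin_sverak_pressure_decay) (hLR : lemarieRieusset_epsilon_regularity) :
    UnitScaleOffAxisBound := by
  obtain ⟨Φ₆, hΦ₆m, h6⟩ := sixthPower_le_of_offAxisL6Bound h44 hreg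
  obtain ⟨c, h22⟩ := h22
  obtain ⟨ε₀, C₀, hε₀, hC₀, H⟩ := hLR 1 3 one_pos (by norm_num)
  obtain ⟨σ, hσ0, hσ1, hcσ⟩ := exists_ratio_sq c
  have hσR : (0 : ℝ) < σ := by exact_mod_cast hσ0
  -- the constants: `B = |B₁|`, `a_K = (B Φ₆ K)^{1/2}`, `η = ε₀³`
  set B : ℝ≥0∞ := volume (ball (0 : (EuclideanSpace ℝ (Fin 3))) 1) with hB
  have hBfin : B < ∞ := measure_ball_lt_top
  have hafin : ∀ K : ℝ≥0, (B * (Φ₆ K : ℝ≥0∞)) ^ (2⁻¹ : ℝ) ≠ ∞ := fun K =>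
    ENNReal.rpow_ne_top_of_nonneg (by norm_num) (ENNReal.mul_ne_top hBfin.ne ENNReal.coe_ne_top)
  set a : ℝ≥0 → ℝ≥0 := fun K => ((B * (Φ₆ K : ℝ≥0∞)) ^ (2⁻¹ : ℝ)).toNNReal with ha
  have hacoe : ∀ K, (a K : ℝ≥0∞) = (B * (Φ₆ K : ℝ≥0∞)) ^ (2⁻¹ : ℝ) := fun K =>
    ENNReal.coe_toNNReal (hafin K)
  have hamono : Monotone a := fun K K' h =>
    ENNReal.toNNReal_mono (hafin K')
      (ENNReal.rpow_le_rpow (mul_le_mul' le_rfl (ENNReal.coe_le_coe.2 (hΦ₆m h))) (by norm_num))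
  set η : ℝ≥0 := Real.toNNReal (ε₀ ^ 3) with hη
  have hη0 : 0 < η := Real.toNNReal_pos.2 (by positivity)
  have hηcoe : (η : ℝ≥0∞) = ENNReal.ofReal (ε₀ ^ 3) := rfl
  -- the scale `ρ_K = s_{k₀(K)}²`
  set ρ : ℝ≥0 → ℝ := fun K =>
    ((epsHalfScale σ (epsIndex c σ η (a K) (16 * K)) : ℝ≥0) : ℝ) ^ 2 with hρ
  have hρpos : ∀ K, 0 < ρ K := fun K => by
    have := (epsHalfScale_pos_sq_le hσ0 hσ1 (epsIndex c σ η (a K) (16 * K))).1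
    positivity
  have hρ4 : ∀ K, ρ K ≤ 1 / 4 := fun K =>
    (epsHalfScale_pos_sq_le hσ0 hσ1 (epsIndex c σ η (a K) (16 * K))).2
  have hρanti : ∀ K K', K ≤ K' → ρ K' ≤ ρ K := by
    intro K K' hKK'
    have hk : epsIndex c σ η (a K) (16 * K) ≤ epsIndex c σ η (a K') (16 * K') :=
      epsIndex_mono c η hσ1 hη0 (hamono hKK') (mul_le_mul' le_rfl hKK')
    have hs := epsHalfScale_antitone hσ1.le hk
    exact pow_le_pow_left₀ (NNReal.coe_nonneg _) (NNReal.coe_le_coe.2 hs) 2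
  refine ⟨fun K => ⟨C₀ * ε₀ / ρ K, (div_pos (mul_pos hC₀ hε₀) (hρpos K)).le⟩, ?_, ?_⟩
  · intro K K' hKK'
    exact Subtype.mk_le_mk.2 (div_le_div_of_nonneg_left (by positivity) (hρpos K')
      (hρanti K K' hKK'))
  intro u p h3 G hG K hK
  have hsuit := h3.isSuitable SuitableOfBounded_holds
  obtain ⟨hA, hE, -, hD⟩ := szEnergy_bounds hK
  have h6K := h6 u p h3 G hG K hK
  have humeas : AEStronglyMeasurable (uncurry u) (volume.restrict (parCyl (0 : ℝ × (EuclideanSpace ℝ (Fin 3))) 3)) :=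
    h3.distributional.1.aestronglyMeasurable
  set k₀ : ℕ := epsIndex c σ η (a K) (16 * K) with hk₀
  have hsk := epsHalfScale_pos_sq_le hσ0 hσ1
  -- the bound on every cylinder `Q_{ρ/2}(z₀)`
  have hcentre : ∀ z₀ ∈ shellCyl 1 2 1 1,
      ∀ᵐ w ∂(volume.restrict (parabolicCylinder (ρ K / 2) z₀)), ‖u w.1 w.2‖ ≤ C₀ * ε₀ / ρ K := by
    intro z₀ h₀
    -- the decay estimate along the scales `s_k²`, inside `Q(0, 3)`
    have h22z : ∀ k, cknD ((σ * (epsHalfScale σ k : ℝ)) ^ 2) z₀ p ≤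
        c * (ENNReal.ofReal ((σ * (epsHalfScale σ k : ℝ)) ^ 2 / (epsHalfScale σ k : ℝ) ^ 2) *
          cknD ((epsHalfScale σ k : ℝ) ^ 2) z₀ p +
          ENNReal.ofReal (((epsHalfScale σ k : ℝ) ^ 2 / (σ * (epsHalfScale σ k : ℝ)) ^ 2) ^ 2) *
          cknC ((epsHalfScale σ k : ℝ) ^ 2) z₀ u) := by
      intro k
      obtain ⟨hs0, hs4⟩ := hsk k
      have hσ1R : (σ : ℝ) ≤ 1 := by exact_mod_cast hσ1.le
      have hle : ((σ : ℝ) * (epsHalfScale σ k : ℝ)) ^ 2 ≤ (epsHalfScale σ k : ℝ) ^ 2 :=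
        pow_le_pow_left₀ (by positivity) (mul_le_of_le_one_left hs0.le hσ1R) 2
      exact h22 (parCylOpens 0 3) u p h3.distributional z₀ _ _ (by positivity) hle
        ((parabolicCylinder_subset_parCyl _ _).trans (parCyl_subset_parCyl_three h₀ hs4))
    -- the Hölder bound on `C` at the scales `s_k`
    have hCk : ∀ k, cknC (((epsHalfScale σ k : ℝ≥0) : ℝ) ^ 2) z₀ u ≤
        ((a K * epsHalfScale σ k : ℝ≥0) : ℝ≥0∞) := by
      intro k
      have := cknC_le_of_sixth_bound humeas h6K h₀ (hsk k).1 (hsk k).2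
      rwa [ENNReal.ofReal_coe_nnreal, ← hacoe, ← ENNReal.coe_mul] at this
    -- `D(s_k²; z₀) ≤ g_k`
    have hDk : ∀ k, cknD (((epsHalfScale σ k : ℝ≥0) : ℝ) ^ 2) z₀ p ≤
        (decayMajorant c σ (a K) (16 * K) k : ℝ≥0∞) := by
      intro k
      induction k with
      | zero =>
        have e0 : ((epsHalfScale σ 0 : ℝ≥0) : ℝ) ^ 2 = 1 / 4 := by
          simp [epsHalfScale]
          norm_num
        rw [e0]
        exact cknD_quarter_le_of_bound h₀ hD
      | succ k ih =>
        obtain ⟨hs0, hs4⟩ := hsk k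
        set s : ℝ := ((epsHalfScale σ k : ℝ≥0) : ℝ) with hs
        have e1 : ((epsHalfScale σ (k + 1) : ℝ≥0) : ℝ) = σ * s := by
          simp [hs, epsHalfScale, pow_succ]
          ring
        have h := h22z k
        obtain ⟨e2, e3⟩ := scale_ratios hσR hs0
        rw [e2, e3, show ENNReal.ofReal ((σ : ℝ) ^ 2) = ((σ ^ 2 : ℝ≥0) : ℝ≥0∞) by
            rw [← NNReal.coe_pow, ENNReal.ofReal_coe_nnreal],
          show ENNReal.ofReal (((σ : ℝ) ^ 4)⁻¹) = (((σ ^ 4)⁻¹ : ℝ≥0) : ℝ≥0∞) by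
            rw [← NNReal.coe_pow, ← NNReal.coe_inv, ENNReal.ofReal_coe_nnreal]] at h
        rw [e1, decayMajorant_succ]
        exact decay_step_ennreal hcσ h ih (hCk k)
    -- smallness at the scale `ρ = s_{k₀}²`
    have hspec := epsIndex_spec c (a K) (16 * K) hσ1 hη0
    have hCD : cknC (ρ K) z₀ u + cknD (ρ K) z₀ p ≤ η :=
      calc cknC (ρ K) z₀ u + cknD (ρ K) z₀ p
          ≤ ((a K * epsHalfScale σ k₀ : ℝ≥0) : ℝ≥0∞) + (decayMajorant c σ (a K) (16 * K) k₀ : ℝ≥0∞) :=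
            add_le_add (hCk k₀) (hDk k₀)
        _ ≤ η := by rw [add_comm]; exact_mod_cast hspec
    have humeasρ : AEMeasurable (fun z : ℝ × (EuclideanSpace ℝ (Fin 3)) => ‖u z.1 z.2‖ₑ ^ (3 : ℕ))
        (volume.restrict (parabolicCylinder (ρ K) z₀)) :=
      ((humeas.mono_measure (Measure.restrict_mono ((parabolicCylinder_subset_parCyl _ _).trans
        (parCyl_subset_parCyl_three h₀ (hρ4 K))) le_rfl)).enorm.pow_const _)
    have hsmall : ∫⁻ w in parabolicCylinder (ρ K) z₀,
        (‖u w.1 w.2‖ₑ ^ (3 : ℕ) + ‖p w.1 w.2‖ₑ ^ (3 / 2 : ℝ)) ≤ ENNReal.ofReal (ε₀ ^ 3 * ρ K ^ 2) :=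
      calc ∫⁻ w in parabolicCylinder (ρ K) z₀, (‖u w.1 w.2‖ₑ ^ (3 : ℕ) + ‖p w.1 w.2‖ₑ ^ (3 / 2 : ℝ))
          = ENNReal.ofReal (ρ K) ^ 2 * (cknC (ρ K) z₀ u + cknD (ρ K) z₀ p) := by
            rw [lintegral_add_left' humeasρ, setLIntegral_eq_mul_cknC z₀ (hρpos K),
              setLIntegral_eq_mul_cknD z₀ (hρpos K), mul_add]
        _ ≤ ENNReal.ofReal (ρ K) ^ 2 * η := mul_le_mul' le_rfl hCD
        _ = ENNReal.ofReal (ε₀ ^ 3 * ρ K ^ 2) := by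
            rw [hηcoe, ← ENNReal.ofReal_pow (hρpos K).le, ← ENNReal.ofReal_mul (by positivity),
              mul_comm]
    exact ae_bound_of_epsilonRegularity H hε₀ h₀ hsuit hG hA hE hD (hρpos K) (hρ4 K) hsmall
  exact ae_innerShell_of_centres (P := fun w => ‖u w.1 w.2‖ ≤ C₀ * ε₀ / ρ K) (hρpos K) hcentre

/-- **Seregin–Šverák 2009, Proposition 3.7, from the printed inputs all the way down**: Lemma 3.5
(`ScaledEnergyBound`), Seregin–Zajaczkowski 2007 Cor. 4.4 (`OffAxisL6Bound`) with the off-axis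
smoothness of the pairs (`OffAxisSmoothRepresentative`), the decay estimate for the pressure
(`seregin_sverak_pressure_decay`) and the ε-regularity criterion
(`lemarieRieusset_epsilon_regularity`) give `|x'| |v| ≤ C₁` a.e. on `Q(1/8)` (`AxisDecayBound`), through
`unitScaleOffAxisBound_of_inputs`, the inverse scaling `offAxisBound_of_unitScaleOffAxisBound` and
the covering `axisDecayBound_of_offAxisBound`. [cite: SereginSverak2009, Prop. 3.7 and its proof (arXiv p. 10)] -/
theorem axisDecayBound_of_inputs (h35 : ScaledEnergyBound) (h44 : OffAxisL6Bound)
    (hreg : OffAxisSmoothRepresentative) (h22 : seregin_sverak_pressure_decay)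
    (hLR : lemarieRieusset_epsilon_regularity) : AxisDecayBound :=
  axisDecayBound_of_unitScaleOffAxisBound h35 (unitScaleOffAxisBound_of_inputs h44 hreg h22 hLR)

end SereginSverak2009

end Literature.Analysis.FluidPDE
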